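import Literature.Geometry.DiscreteGeometry.ContactGraphBoundarySimple
import HarnessLib

/-!
# Harborth's boundary inequality: `∑_{boundary} deg ≤ 4a - 6`

Topic `Literature/Geometry/DiscreteGeometry`, seventh file of the proof of Harborth's upper bound
[Harborth1974, (5)]; sequel to `ContactGraphBoundarySimple.lean` (the boundary walk `bdry` of a
non-splitting configuration visits each of its centres once per period). Here the walk becomes
Harborth's "einfach geschlossenes Randpolygon mit `a` Eckpunkten" (`isSimplePolygon_bdry`,
`a = period ≥ 3`), run counter-clockwise (`sum_extAngle_bdry`: the exterior angles sum to `+2π`,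
Hopf's Umlaufsatz with the sign fixed at the lowest vertex), and we derive Harborth's inequality
(2), "`3a - 6 ≥ k₂ + 2k₃ + 3k₄ + 4k₅`", in the summed form the induction consumes:

* `gapAngle_bdry` — at a boundary vertex the traced (outer) gap is `π +` the exterior angle, so
  the interior angle is `π -` the exterior angle and the interior angles sum to `(a - 2)π`;
* `sum_card_nbrs_bdry_le` — `∑_{m < a} deg (bdry m) ≤ 4a - 6` (each boundary vertex of degree
  `j` has interior angle `≥ (j - 1)π/3`, `card_nbrs_sub_one_mul_le_gap`);
* `exists_boundary_set` — the boundary set `S` (`a = #S ≥ 3` centres, `∑_S deg ≤ 4a - 6`, at least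
  `2a` darts inside `S`, all degrees `≤ 6`) required by the induction theorem
  `Harborth.card_darts_le_of_boundary` of `HarborthInduction.lean`, for every hard non-splitting
  configuration of at least `4` (indeed `3`) discs; non-splitting forces every disc to touch at
  least two others (`two_le_card_nbrs_of_not_splits`, Harborth: "Bei einer maximalen Lagerung
  berührt jeder Kreis mindestens zwei andere").
-/

noncomputable section

namespace Literature.Geometry.DiscreteGeometry

namespace Harborth

open Complex Set Finset Metric
open Literature.Topology.PlaneTopology
open scoped Real

variable {P : Finset ℂ}

/-- A periodic sequence only depends on the index modulo the period (local copy). [folklore] -/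
private theorem periodic_apply_emod {z : ℤ → ℂ} {n : ℕ} (hper : Function.Periodic z n) (k : ℤ) :
    z k = z (k % n) := by
  conv_lhs => rw [← Int.emod_add_mul_ediv k n, mul_comm]
  exact hper.int_mul _ _

/-! ## §1 Every disc touches two others -/

/-- **In a non-splitting configuration of at least three discs every disc touches at least two
others** (an isolated disc splits off; a disc touching only `u` makes `u` a cut disc).
[cite: Harborth1974, p. 14] -/
theorem two_le_card_nbrs_of_not_splits (h3 : 3 ≤ P.card) (hns : ¬ Splits P) {v : ℂ} (hv : v ∈ P) :
    2 ≤ (nbrs P v).card := by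
  classical
  by_contra hlt
  push Not at hlt
  apply hns
  have hsub : nbrs P v ⊆ P := Finset.filter_subset _ _
  rcases Nat.lt_or_ge (nbrs P v).card 1 with h0 | h1
  · -- no neighbour: `{v}` splits off
    have h0' : nbrs P v = ∅ := Finset.card_eq_zero.1 (by omega)
    refine Or.inl ⟨{v}, P.erase v, ⟨v, Finset.mem_singleton_self v⟩, ?_, ?_, ?_, ?_⟩
    · rw [← Finset.card_pos, Finset.card_erase_of_mem hv]; omega
    · rw [Finset.disjoint_singleton_left]; exact Finset.notMem_erase v P
    · rw [Finset.singleton_union]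
      exact Finset.insert_erase hv
    · intro a ha b hb hab
      rw [Finset.mem_singleton] at ha
      have : b ∈ nbrs P v := mem_nbrs.2 ⟨Finset.mem_of_mem_erase hb, by rw [← ha]; exact hab⟩
      rw [h0'] at this
      exact Finset.notMem_empty b this
  · -- exactly one neighbour `u`: a cut disc
    have h1' : (nbrs P v).card = 1 := by omega
    obtain ⟨u, hu⟩ := Finset.card_eq_one.1 h1'
    have huN : u ∈ nbrs P v := by rw [hu]; exact Finset.mem_singleton_self u
    have huP : u ∈ P := (mem_nbrs.1 huN).1
    have huv : u ≠ v := ne_of_mem_nbrs huN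
    refine Or.inr ⟨u, {v}, (P.erase u).erase v, by rwa [Finset.mem_singleton], ?_,
      ⟨v, Finset.mem_singleton_self v⟩, ?_, ?_, ?_, ?_⟩
    · intro h
      exact Finset.notMem_erase u P (Finset.mem_of_mem_erase h)
    · rw [← Finset.card_pos, Finset.card_erase_of_mem (Finset.mem_erase.2 ⟨huv.symm, hv⟩),
        Finset.card_erase_of_mem huP]
      omega
    · rw [Finset.disjoint_singleton_left]; exact Finset.notMem_erase v _
    · ext x
      simp only [Finset.mem_insert, Finset.mem_union, Finset.mem_singleton, Finset.mem_erase]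
      constructor
      · rintro (rfl | rfl | ⟨-, -, hx⟩)
        · exact huP
        · exact hv
        · exact hx
      · intro hx
        by_cases hxu : x = u
        · exact Or.inl hxu
        by_cases hxv : x = v
        · exact Or.inr (Or.inl hxv)
        · exact Or.inr (Or.inr ⟨hxv, hxu, hx⟩)
    · intro a ha b hb hab
      rw [Finset.mem_singleton] at ha
      have hbP : b ∈ P := Finset.mem_of_mem_erase (Finset.mem_of_mem_erase hb)
      have : b ∈ nbrs P v := mem_nbrs.2 ⟨hbP, by rw [← ha]; exact hab⟩
      rw [hu, Finset.mem_singleton] at this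
      rw [this] at hb
      exact Finset.notMem_erase u P (Finset.mem_of_mem_erase hb)

/-! ## §2 The boundary polygon -/

section Cycle

variable {hne : P.Nonempty} {h2 : ∀ p ∈ P, 2 ≤ (nbrs P p).card}

/-- Consecutive boundary centres are at distance one. [cite: Harborth1974, p. 14] -/
theorem norm_bdry_succ_sub (m : ℤ) : ‖bdry P hne h2 (m + 1) - bdry P hne h2 m‖ = 1 :=
  (mem_darts.1 (bdry_mem_darts (hne := hne) (h2 := h2) m)).2

/-- The previous boundary centre is a neighbour. [cite: Harborth1974, p. 14] -/
theorem bdry_pred_mem_nbrs (m : ℤ) : bdry P hne h2 (m - 1) ∈ nbrs P (bdry P hne h2 m) := by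
  have := bdry_mem_darts (hne := hne) (h2 := h2) (m - 1)
  rw [sub_add_cancel] at this
  exact mem_nbrs_of_mk_mem_darts' this

/-- The next boundary centre is a neighbour. [cite: Harborth1974, p. 14] -/
theorem bdry_succ_mem_nbrs (m : ℤ) : bdry P hne h2 (m + 1) ∈ nbrs P (bdry P hne h2 m) :=
  mem_nbrs_of_mk_mem_darts (bdry_mem_darts m)

/-- **The boundary polygon has at least three vertices.** [cite: Harborth1974, p. 14] -/
theorem three_le_period : 3 ≤ period P hne h2 := by
  have hT := period_pos (hne := hne) (h2 := h2)
  have hper := bdry_periodic (hne := hne) (h2 := h2)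
  -- period `1`: a disc would touch itself; period `2`: the successor would be a U-turn
  have h1 : period P hne h2 ≠ 1 := by
    intro h
    have e : bdry P hne h2 1 = bdry P hne h2 0 := by
      have := hper 0; rw [h, Nat.cast_one, zero_add] at this; exact this
    have := norm_bdry_succ_sub (hne := hne) (h2 := h2) 0
    rw [zero_add, e, sub_self, norm_zero] at this
    exact zero_ne_one this
  have h2' : period P hne h2 ≠ 2 := by
    intro h
    have e : bdry P hne h2 2 = bdry P hne h2 0 := by
      have := hper 0; rw [h, Nat.cast_ofNat, zero_add] at this; exact this
    have hs := bdry_add_two (hne := hne) (h2 := h2) 0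
    rw [zero_add, zero_add, e] at hs
    exact succ_ne (h2 _ (bdry_mem 1)) hs.symm
  omega

/-- Equal boundary centres have indices congruent modulo the period (non-splitting
configurations). [cite: Harborth1974, p. 14] -/
theorem emod_eq_of_bdry_eq (hP : IsHard P) (hns : ¬ Splits P) {i j : ℤ}
    (h : bdry P hne h2 i = bdry P hne h2 j) : i % (period P hne h2 : ℤ) = j % (period P hne h2 : ℤ) := by
  have hT := period_pos (hne := hne) (h2 := h2)
  have hT0 : (period P hne h2 : ℤ) ≠ 0 := by exact_mod_cast hT.ne'
  have hper := bdry_periodic (hne := hne) (h2 := h2)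
  rw [periodic_apply_emod hper i, periodic_apply_emod hper j] at h
  have hi := Int.emod_nonneg i hT0
  have hj := Int.emod_nonneg j hT0
  have hi' := Int.emod_lt_of_pos i (show (0 : ℤ) < period P hne h2 by exact_mod_cast hT)
  have hj' := Int.emod_lt_of_pos j (show (0 : ℤ) < period P hne h2 by exact_mod_cast hT)
  rw [← Int.toNat_of_nonneg hi, ← Int.toNat_of_nonneg hj] at h ⊢
  have := bdry_injOn hP hns (by omega) (by omega) h
  rw [this]

/-- **The boundary walk is a simple closed polygon** (Harborth's "einfach geschlossenes
Randpolygon"), for a hard non-splitting configuration all of whose discs touch two others.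
[cite: Harborth1974, p. 14] -/
theorem isSimplePolygon_bdry (hP : IsHard P) (hns : ¬ Splits P) :
    IsSimplePolygon (bdry P hne h2) (period P hne h2) := by
  refine isSimplePolygon_of_cycle hP three_le_period bdry_periodic bdry_mem norm_bdry_succ_sub
    fun i j hi0 hin hj0 hjn h => ?_
  have := emod_eq_of_bdry_eq hP hns h
  rwa [Int.emod_eq_of_lt hi0 hin, Int.emod_eq_of_lt hj0 hjn] at this

/-- **The boundary polygon is run counter-clockwise**: its exterior angles sum to `+2π` (Hopf's
Umlaufsatz; the sign is fixed at the lowest vertex, where the walk leaves to the right of where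
it arrives). [cite: Harborth1974, (2)] -/
theorem sum_extAngle_bdry (hP : IsHard P) (hns : ¬ Splits P) :
    ∑ i ∈ Finset.range (period P hne h2), extAngle (bdry P hne h2) i = 2 * π := by
  have hZ := isSimplePolygon_bdry (hne := hne) (h2 := h2) hP hns
  refine hZ.sum_extAngle_eq_two_pi_of_lowest im_bdry_zero_le ?_
  have := arg_bdry_one_lt (hne := hne) (h2 := h2)
  rwa [hZ.vertex_neg_one] at this

/-- **The traced gap is the outer angle**: at the boundary vertex `bdry m` the gap from the
previous centre to the next one (counter-clockwise) is `π +` the exterior angle of the polygon;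
the interior angle is therefore `π -` the exterior angle. [cite: Harborth1974, (2)] -/
theorem gapAngle_bdry (hP : IsHard P) (hns : ¬ Splits P) (m : ℤ) :
    gapAngle P (bdry P hne h2 (m - 1)) (bdry P hne h2 m) = π + extAngle (bdry P hne h2) m := by
  set z := bdry P hne h2
  have hs : succ P (z (m - 1)) (z m) = z (m + 1) := by
    have := bdry_add_two (hne := hne) (h2 := h2) (m - 1)
    rw [show m - 1 + 2 = m + 1 by ring, sub_add_cancel] at this
    exact this.symm
  rw [gapAngle, hs]
  have hext := (isSimplePolygon_bdry (hne := hne) (h2 := h2) hP hns).abs_extAngle_lt_pi m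
  rw [abs_lt] at hext
  have hu : z (m - 1) - z m ≠ 0 := sub_ne_zero_of_mem_nbrs (bdry_pred_mem_nbrs m)
  have hw : z (m + 1) - z m ≠ 0 := sub_ne_zero_of_mem_nbrs (bdry_succ_mem_nbrs m)
  have hπ := Real.pi_pos
  refine ccwAngle_eq_of_coe_eq (by linarith) (by linarith) ?_
  rw [extAngle, Real.Angle.coe_add, arg_div_coe_angle hw (by rwa [← neg_sub, neg_ne_zero]),
    show z m - z (m - 1) = -(z (m - 1) - z m) by ring, arg_neg_coe_angle hu]
  abel

/-- **Harborth's inequality (2), summed over the boundary**: `∑_{m < a} deg (bdry m) ≤ 4a - 6`.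
At the boundary vertex `bdry m` of degree `j` the interior angle `π - ext_m` is at least
`(j - 1)π/3`; summing, `(∑ deg - a) π/3 ≤ aπ - 2π`. [cite: Harborth1974, (2)] -/
theorem sum_card_nbrs_bdry_le (hP : IsHard P) (hns : ¬ Splits P) :
    (∑ m ∈ Finset.range (period P hne h2), ((nbrs P (bdry P hne h2 m)).card : ℝ)) + 6 ≤
      4 * period P hne h2 := by
  have hπ := Real.pi_pos
  have hsum := sum_extAngle_bdry (hne := hne) (h2 := h2) hP hns
  have hloc : ∀ m ∈ Finset.range (period P hne h2),
      (((nbrs P (bdry P hne h2 m)).card : ℝ) - 1) * (π / 3) ≤ π - extAngle (bdry P hne h2) m := by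
    intro m _
    have := card_nbrs_sub_one_mul_le_gap hP (bdry_pred_mem_nbrs (hne := hne) (h2 := h2) (m : ℤ))
    rw [gapAngle_bdry hP hns] at this
    linarith
  have := Finset.sum_le_sum hloc
  rw [← Finset.sum_mul, Finset.sum_sub_distrib, Finset.sum_sub_distrib, hsum] at this
  simp only [Finset.sum_const, Finset.card_range, nsmul_eq_mul, mul_one] at this
  nlinarith

/-! ## §3 The boundary set -/

/-- The **boundary set**: the centres of the boundary polygon. [cite: Harborth1974, p. 14] -/
def bdrySet (P : Finset ℂ) (hne : P.Nonempty) (h2 : ∀ p ∈ P, 2 ≤ (nbrs P p).card) : Finset ℂ :=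
  (Finset.range (period P hne h2)).image fun m : ℕ => bdry P hne h2 m

/-- The boundary set consists of centres. [cite: Harborth1974, p. 14] -/
theorem bdrySet_subset : bdrySet P hne h2 ⊆ P := by
  intro x hx
  obtain ⟨m, -, rfl⟩ := Finset.mem_image.1 hx
  exact bdry_mem _

/-- Every boundary centre (any integer index) lies in the boundary set. [cite: Harborth1974, p. 14] -/
theorem bdry_mem_bdrySet (m : ℤ) : bdry P hne h2 m ∈ bdrySet P hne h2 := by
  have hT := period_pos (hne := hne) (h2 := h2)
  have hT0 : (period P hne h2 : ℤ) ≠ 0 := by exact_mod_cast hT.ne'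
  rw [periodic_apply_emod bdry_periodic m, ← Int.toNat_of_nonneg (Int.emod_nonneg m hT0)]
  refine Finset.mem_image.2 ⟨_, Finset.mem_range.2 ?_, rfl⟩
  have := Int.emod_lt_of_pos m (show (0 : ℤ) < period P hne h2 by exact_mod_cast hT)
  omega

/-- **The boundary polygon has `a = period` distinct vertices.** [cite: Harborth1974, (1)] -/
theorem card_bdrySet (hP : IsHard P) (hns : ¬ Splits P) : (bdrySet P hne h2).card = period P hne h2 := by
  rw [bdrySet, Finset.card_image_of_injOn, Finset.card_range]
  intro i hi j hj h
  exact bdry_injOn hP hns (Finset.mem_range.1 (Finset.mem_coe.1 hi))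
    (Finset.mem_range.1 (Finset.mem_coe.1 hj)) h

/-- **`∑_{v ∈ boundary} deg v ≤ 4a - 6`.** [cite: Harborth1974, (2)] -/
theorem sum_card_nbrs_bdrySet_le (hP : IsHard P) (hns : ¬ Splits P) :
    (∑ v ∈ bdrySet P hne h2, ((nbrs P v).card : ℤ)) + 6 ≤ 4 * (bdrySet P hne h2).card := by
  have hinj : Set.InjOn (fun m : ℕ => bdry P hne h2 m) (Finset.range (period P hne h2) : Set ℕ) :=
    fun i hi j hj h => bdry_injOn hP hns (Finset.mem_range.1 (Finset.mem_coe.1 hi))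
      (Finset.mem_range.1 (Finset.mem_coe.1 hj)) h
  rw [card_bdrySet hP hns, bdrySet, Finset.sum_image hinj]
  have := sum_card_nbrs_bdry_le (hne := hne) (h2 := h2) hP hns
  have e : ((∑ m ∈ Finset.range (period P hne h2), ((nbrs P (bdry P hne h2 m)).card : ℤ) : ℤ) : ℝ) =
      ∑ m ∈ Finset.range (period P hne h2), ((nbrs P (bdry P hne h2 m)).card : ℝ) := by
    push_cast; rfl
  have : ((∑ m ∈ Finset.range (period P hne h2), ((nbrs P (bdry P hne h2 m)).card : ℤ) : ℤ) : ℝ) + 6 ≤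
      4 * (period P hne h2 : ℝ) := by rw [e]; exact this
  exact_mod_cast this

/-- **Each boundary vertex has two boundary neighbours**, so the boundary set carries at least
`2a` darts. [cite: Harborth1974, p. 14] -/
theorem two_mul_card_le_card_darts_bdrySet (hP : IsHard P) (hns : ¬ Splits P) :
    2 * (bdrySet P hne h2).card ≤ (darts (bdrySet P hne h2)).card := by
  classical
  rw [card_darts_eq_sum, mul_comm]
  refine le_trans (by rw [Finset.sum_const, smul_eq_mul]) (Finset.sum_le_sum fun v hv => ?_)
  obtain ⟨m, -, rfl⟩ := Finset.mem_image.1 hv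
  -- the two neighbours `bdry (m-1) ≠ bdry (m+1)` along the polygon
  have hT3 := three_le_period (hne := hne) (h2 := h2)
  have hne2 : bdry P hne h2 ((m : ℤ) - 1) ≠ bdry P hne h2 ((m : ℤ) + 1) := by
    intro h
    have hm := emod_eq_of_bdry_eq hP hns h
    have hd : ((period P hne h2 : ℕ) : ℤ) ∣ ((m : ℤ) + 1) - ((m : ℤ) - 1) := Int.modEq_iff_dvd.1 hm
    rw [show ((m : ℤ) + 1) - ((m : ℤ) - 1) = 2 by ring] at hd
    have : ((period P hne h2 : ℕ) : ℤ) ≤ 2 := Int.le_of_dvd (by norm_num) hd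
    omega
  have hsub : ({bdry P hne h2 ((m : ℤ) - 1), bdry P hne h2 ((m : ℤ) + 1)} : Finset ℂ) ⊆
      nbrs (bdrySet P hne h2) (bdry P hne h2 m) := by
    intro x hx
    rw [Finset.mem_insert, Finset.mem_singleton] at hx
    rcases hx with rfl | rfl
    · exact mem_nbrs.2 ⟨bdry_mem_bdrySet _, (mem_nbrs.1 (bdry_pred_mem_nbrs (m : ℤ))).2⟩
    · exact mem_nbrs.2 ⟨bdry_mem_bdrySet _, (mem_nbrs.1 (bdry_succ_mem_nbrs (m : ℤ))).2⟩
  have := Finset.card_le_card hsub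
  rwa [Finset.card_pair hne2] at this

end Cycle

/-- **The boundary set of a non-splitting configuration** (input of the induction
`Harborth.card_darts_le_of_boundary`): for a hard configuration of at least four discs that does
not split there is a set `S` of `a ≥ 3` of its discs with `∑_{v ∈ S} deg v ≤ 4a - 6`, at least
`2a` darts inside `S`, and all degrees are `≤ 6`. [cite: Harborth1974, (1)–(2)] -/
theorem exists_boundary_set (P : Finset ℂ) (hP : IsHard P) (h4 : 4 ≤ P.card) (hns : ¬ Splits P) :
    ∃ S ⊆ P, 3 ≤ S.card ∧ (∑ v ∈ S, ((nbrs P v).card : ℤ)) + 6 ≤ 4 * S.card ∧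
      2 * S.card ≤ (darts S).card ∧ ∀ v ∈ P, (nbrs P v).card ≤ 6 := by
  have hne : P.Nonempty := Finset.card_pos.1 (by omega)
  have h2 : ∀ p ∈ P, 2 ≤ (nbrs P p).card := fun p hp => two_le_card_nbrs_of_not_splits (by omega) hns hp
  refine ⟨bdrySet P hne h2, bdrySet_subset, ?_, sum_card_nbrs_bdrySet_le hP hns,
    two_mul_card_le_card_darts_bdrySet hP hns, fun v _ => card_nbrs_le_six hP v⟩
  rw [card_bdrySet hP hns]; exact three_le_period

/-- **Harborth 1974, (5), for configurations in `ℂ`**: a hard configuration of `n` unit discs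
has at most `[3n - √(12n - 3)]` contact pairs, i.e. `#darts ≤ 2 [3n - √(12n - 3)]`.
[cite: Harborth1974, (5)] -/
theorem card_darts_le (P : Finset ℂ) (hP : IsHard P) : ((darts P).card : ℤ) ≤ 2 * harborthNumber P.card :=
  card_darts_le_of_boundary exists_boundary_set P hP

end Harborth

end Literature.Geometry.DiscreteGeometry

end
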